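import Mathlib.Data.Finset.Card
import Mathlib.Data.Fintype.Basic
import Mathlib.Data.Fintype.Card
import Mathlib.Data.Fintype.Prod
import Mathlib.Data.Finset.Image
import HarnessLib

/-!
# [GenEll] Thm. 2.1 (ii) ⇒ (i) for `ℙ¹`: the combinatorial core of the finite MENU argument

S. Mochizuki, *Arithmetic elliptic curves in general position*, Math. J. Okayama Univ. 52 (2010)
[cite: MochizukiGenEll2010, Thm 2.1 p.12], proof of Thm. 2.1, p. 12: the noncritical Belyi map is
chosen AFTER passing to a convergent subsequence of the (unordered) tuples of conjugates ("there exists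
a subset `Ξ` … such that … the [unordered] d-tuples of Q-conjugates of points ∈ Ξ converge"), i.e. by
compactness finitely many maps suffice (Scherr–Zieve 2014, Thm. 3: `n+1` Belyi maps account for all
`n`-element sets `T`). In the number-field route to `GenEllTwo` (abc-iut cell, GENELLTWO-P1ROUTE §4) the
compactness is replaced by an explicit finite menu of mechanisms indexed by exponent tuples
`i : Fin k → Fin n` (depth-`k` composites of cusp-preserving maps, `n` exponents per level), each with a
finite set `Z i` of "bad points"; a point of degree `≤ d` presents at most `m = 2d` "slots" (its
conjugates at `∞` and at `2`), and defeats mechanism `i` only through a slot lying at a bad point of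
`Z i`. The torsion-loci analysis (W8-elem, W8-support) shows that every bad point `z` DEPENDS on at least
one (level, exponent) pair: `z ∈ Z i` forces `i l = e` for every `(l, e)` in a nonempty "signature" of `z`.

This file proves the resulting pigeonhole, free of all arithmetic:

* `exists_forall_not_mem_of_signature` — if every bad point has a nonempty signature and the number
  of slots is `< n`, some index `i` is defeated by no slot (choose at each level an exponent outside the
  `< n` forbidden ones).

Theorems only; no definitions, no named facts.
-/

namespace Literature.NumberTheory.DiophantineGeometry.GenEll

/-- **Menu pigeonhole.** Indices `i : Fin k → Fin n`; bad sets `Z i ⊆ B`; every bad point `z` carries a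
finite signature `sig z ⊆ Fin k × Fin n` such that `z ∈ Z i → i l = e` for all `(l, e) ∈ sig z`, nonempty
for the points of the finite slot set `H`. If `H.card < n` then some index `i` has `H ∩ Z i = ∅`: pick for
each `z ∈ H` one pair `(l_z, e_z) ∈ sig z`; at each level `l` fewer than `n` exponents are so named, choose
`i l` outside them; then `i l_z ≠ e_z`, so `z ∉ Z i`. (Finite-menu form of the compactness step of
[GenEll] Thm. 2.1, p. 12.) [cite: MochizukiGenEll2010, Thm 2.1 p.12] -/
theorem exists_forall_not_mem_of_signature {k n : ℕ} {B : Type*} (Z : (Fin k → Fin n) → Set B)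
    (sig : B → Finset (Fin k × Fin n))
    (hsig : ∀ (z : B) (i : Fin k → Fin n), z ∈ Z i → ∀ le ∈ sig z, i le.1 = le.2)
    (H : Finset B) (hne : ∀ z ∈ H, (sig z).Nonempty) (hcard : H.card < n) :
    ∃ i : Fin k → Fin n, ∀ z ∈ H, z ∉ Z i := by
  classical
  -- one witnessing pair per slot
  choose pr hpr using hne
  -- at each level, the named exponents are fewer than `n`, so one is free
  have hfree : ∀ l : Fin k, ∃ e : Fin n, ∀ (z : B) (hz : z ∈ H), (pr z hz).1 = l → (pr z hz).2 ≠ e := by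
    intro l
    set F : Finset (Fin n) :=
      (H.attach.filter fun z => (pr z.1 z.2).1 = l).image fun z => (pr z.1 z.2).2 with hF
    have hFcard : F.card < n := by
      calc F.card ≤ (H.attach.filter fun z => (pr z.1 z.2).1 = l).card := Finset.card_image_le
        _ ≤ H.attach.card := Finset.card_filter_le _ _
        _ = H.card := Finset.card_attach
        _ < n := hcard
    obtain ⟨e, -, he⟩ := Finset.exists_mem_notMem_of_card_lt_card
      (s := F) (t := Finset.univ) (by rw [Finset.card_univ, Fintype.card_fin]; exact hFcard)
    refine ⟨e, fun z hz hl heq => he ?_⟩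
    rw [hF, Finset.mem_image]
    exact ⟨⟨z, hz⟩, Finset.mem_filter.mpr ⟨Finset.mem_attach _ _, hl⟩, heq⟩
  choose i hi using hfree
  refine ⟨i, fun z hz hzZ => ?_⟩
  have h1 := hsig z i hzZ (pr z hz) (hpr z hz)
  exact hi (pr z hz).1 z hz rfl h1.symm

end Literature.NumberTheory.DiophantineGeometry.GenEll
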